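import Summits.NavierStokesRegularity.NavierStokesRegularity.Theorems.TypeILiouvilleTypeIliouvilleNoTypeIIEternalEnergyLiouvilleLineInvariant
import Literature.Analysis.UnboundedOperators.HeatKernelBoundedData
import HarnessLib

/-!
# EEL′ on the 2½-dimensional stratum, unconditionally: line-invariant profiles vanish (crux
# `TypeIliouvilleNoTypeII`, stmt-NavierStokesRegularity-0056; rigidity residual EEL′ of the
# pressure-free eternal split)

Helper file (theorems only), the axial half of `…EternalEnergyLiouvilleLineInvariant.lean`.  There,
KNSS's planar Liouville theorem (Thm 5.1, tree) and the `A`-bound made every bounded eternal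
Oseen-mild smooth divergence-free profile that is invariant under `x ↦ x + δ e₁` UNIDIRECTIONAL,
`v = v₁ e₁` with `v₁` independent of `x₁`.  Here:

* `oseenDuhamel_eq_zero_of_axial_lineInvariant` — for such a field the Oseen term vanishes (the inner
  integral `∫ K(t-τ, x-y)[v₁e₁, v] dy = 0` for data independent of `y₁`, tree
  `integral_oseenKernel_sub_smul_single_left`, exactly as in the axial half of KNSS Thm 6.2,
  `KNSS2009_typeI_rate_liouville_axial`), so `v(t) = e^{(t-s)Δ} v(s)` for all `s < t`: an eternal
  bounded CALORIC field;
* `fderiv_eq_zero_of_axial_lineInvariant` — hence `∇v ≡ 0`: `‖∇ e^{(t-s)Δ} v(s)‖ ≤ C (t-s)^{-1/2} sup‖v‖`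
  (`norm_fderiv_heatExtension_le_of_bounded`) and `s → -∞` (no decay hypothesis is needed — the
  parabolic Liouville theorem for bounded ancient caloric functions);
* `lineInvariant_eq_zero` — with the `A`-bound the constant slices vanish: **every line-invariant
  member of the EEL′ class is identically zero**;
* `eternalLiouvillePressureFree_lineInvariant` — EEL′ on the 2½D stratum in the exact `hEEL` shape
  (the `C`- and `E`-clauses are NOT used).

So EEL′ is a theorem on the steady, time-periodic, axisymmetric-no-swirl, discretely self-similar AND
2½-dimensional strata; its open core is transient, genuinely three-dimensional and non-self-similar.
WHAT THIS IS NOT: not NS; EEL′ stays OPEN. [folklore]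
-/

noncomputable section

-- the summit and its single problem share the name `NavierStokesRegularity` (D-0017 nested layout)
set_option linter.dupNamespace false

open Set Function Filter Topology MeasureTheory Metric WithLp
open scoped NNReal ENNReal

namespace Summit.NavierStokesRegularity.NavierStokesRegularity.Theorems.TypeIliouvilleNoTypeII.TypeIIZoom

open Literature.Analysis Literature.Analysis.FluidPDE

variable {v : ℝ → EuclideanSpace ℝ (Fin 3) → EuclideanSpace ℝ (Fin 3)}

/-- **The Oseen term of a line-invariant unidirectional field vanishes.**  If `v` is jointly
continuous, bounded, invariant under `x ↦ x + δ e₁`, and axial (`v₀ = v₂ = 0`), then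
`B¹_s(v, v)(t)(x) = 0` for all `s`, `t`, `x` (adapted from the axial half of KNSS Thm 6.2 in the
tree, `KNSS2009_typeI_rate_liouville_axial`). [cite: KochNadirashviliSereginSverak2009, proof of Thm 6.2 (arXiv:0709.3599 p. 13)] -/
theorem oseenDuhamel_eq_zero_of_axial_lineInvariant (hcont : Continuous (uncurry v))
    (hbdd : ∃ C : ℝ, ∀ t x, ‖v t x‖ ≤ C)
    (hinv : ∀ (t : ℝ) (x : EuclideanSpace ℝ (Fin 3)) (δ : ℝ), v t (x + EuclideanSpace.single 1 δ) = v t x)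
    (hhor : ∀ (t : ℝ) (x : EuclideanSpace ℝ (Fin 3)), v t x 0 = 0 ∧ v t x 2 = 0)
    (s t : ℝ) (x : EuclideanSpace ℝ (Fin 3)) : oseenDuhamel 1 s v v t x = 0 := by
  -- adapted from Literature/Analysis/FluidPDE/KNSSTypeIRateLiouville.lean (`hD` in the axial half)
  obtain ⟨K, hK⟩ := hbdd
  have hWc : ∀ τ, Continuous (v τ) := fun τ => hcont.comp (Continuous.prodMk_right τ)
  have hax : ∀ τ y, v τ y = v τ y 1 • EuclideanSpace.single (1 : Fin 3) (1 : ℝ) := by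
    intro τ y
    obtain ⟨h0, h2⟩ := hhor τ y
    ext j
    fin_cases j <;> simp [h0, h2]
  rw [oseenDuhamel_apply]
  refine setIntegral_eq_zero_of_forall_eq_zero fun τ hτ => ?_
  have hσ : 0 < 1 * (t - τ) := by rw [one_mul]; exact sub_pos.2 hτ.2
  have heq : (fun y => oseenKernel (1 * (t - τ)) (x - y) (v τ y) (v τ y)) =
      fun y => oseenKernel (1 * (t - τ)) (x - y)
        (v τ y 1 • EuclideanSpace.single (1 : Fin 3) (1 : ℝ)) (v τ y) :=
    funext fun y => by rw [← hax τ y]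
  rw [heq]
  have hgc : Continuous fun y : EuclideanSpace ℝ (Fin 3) => v τ y 1 :=
    (PiLp.continuous_apply 2 _ 1).comp (hWc τ)
  have hb1 : ∀ y, |v τ y 1| ≤ K := fun y =>
    (Real.norm_eq_abs _ ▸ PiLp.norm_apply_le (v τ y) 1).trans (hK τ y)
  exact integral_oseenKernel_sub_smul_single_left hσ (g := fun y => v τ y 1) (c := fun y => v τ y)
    hgc.aestronglyMeasurable (hWc τ).aestronglyMeasurable hb1 (fun y => hK τ y)
    (fun y δ => by rw [hinv τ y δ]) (fun y δ => hinv τ y δ) x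

/-- **Line-invariant EEL′-class profiles have `∇v ≡ 0`.**  By `horizontal_eq_zero_of_lineInvariant`
the field is unidirectional, by `oseenDuhamel_eq_zero_of_axial_lineInvariant` it is caloric,
`v(t) = e^{(t-s)Δ} v(s)` for all `s < t`, and `‖∇ e^{(t-s)Δ} v(s)‖ ≤ 2^{3/2} (t-s)^{-1/2} sup ‖v‖ → 0` as
`s → -∞` (`norm_fderiv_heatExtension_le_of_bounded`). [cite: KochNadirashviliSereginSverak2009, Thm 5.1 and proof of Thm 6.2 (arXiv:0709.3599 pp. 9, 13)] -/
theorem fderiv_eq_zero_of_lineInvariant (hv : ContDiff ℝ (⊤ : ℕ∞) (uncurry v))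
    (hdiv : ∀ t, VectorCalculus.IsDivFree (v t))
    (hmild : ∀ s t : ℝ, s < t → ∀ x, v t x = heatFlow (v s) (t - s) x - oseenDuhamel 1 s v v t x)
    (hbdd : ∃ C : ℝ, ∀ t x, ‖v t x‖ ≤ C)
    (hinv : ∀ (t : ℝ) (x : EuclideanSpace ℝ (Fin 3)) (δ : ℝ), v t (x + EuclideanSpace.single 1 δ) = v t x)
    {I : ℝ≥0∞} (hI : I ≠ ⊤)
    (hA : ∀ r : ℝ, 0 < r → ∀ z : ℝ × EuclideanSpace ℝ (Fin 3), cknAEss r z v ≤ I)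
    (t : ℝ) (x : EuclideanSpace ℝ (Fin 3)) : fderiv ℝ (v t) x = 0 := by
  have hhor : ∀ (τ : ℝ) (y : EuclideanSpace ℝ (Fin 3)), v τ y 0 = 0 ∧ v τ y 2 = 0 := fun τ y =>
    horizontal_eq_zero_of_lineInvariant hv hdiv hmild hbdd hinv hI hA τ y
  have hD : ∀ (s : ℝ) (y : EuclideanSpace ℝ (Fin 3)), oseenDuhamel 1 s v v t y = 0 := fun s y =>
    oseenDuhamel_eq_zero_of_axial_lineInvariant hv.continuous hbdd hinv hhor s t y
  obtain ⟨K, hK⟩ := hbdd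
  -- the field is caloric: `v t = e^{(t-s)Δ} v s` for every `s < t`
  have hcal : ∀ s : ℝ, s < t → v t = UnboundedOperators.heatExtension (v s) (t - s) := by
    intro s hst
    funext y
    rw [hmild s t hst y, hD s y, sub_zero, heatFlow_of_pos _ (sub_pos.2 hst)]
  -- gradient bound for every `S = t - s > 0`
  have hslc : ∀ τ, Continuous (v τ) := fun τ => hv.continuous.comp (Continuous.prodMk_right τ)
  have hgrad : ∀ S : ℝ, 0 < S → ‖fderiv ℝ (v t) x‖ ≤
      (2 : ℝ) ^ ((Module.finrank ℝ (EuclideanSpace ℝ (Fin 3)) : ℝ) / 2) * S ^ (-(1 / 2 : ℝ)) * K := by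
    intro S hS
    have h := UnboundedOperators.norm_fderiv_heatExtension_le_of_bounded
      (hslc (t - S)).aestronglyMeasurable (fun z => hK (t - S) z) hS x
    rw [hcal (t - S) (by linarith), show t - (t - S) = S by ring]
    exact h
  -- let `S → ∞`
  have hlim : Tendsto (fun S : ℝ =>
      (2 : ℝ) ^ ((Module.finrank ℝ (EuclideanSpace ℝ (Fin 3)) : ℝ) / 2) * S ^ (-(1 / 2 : ℝ)) * K)
      atTop (𝓝 0) := by
    have h := ((tendsto_rpow_neg_atTop (by norm_num : (0 : ℝ) < 1 / 2)).const_mul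
      ((2 : ℝ) ^ ((Module.finrank ℝ (EuclideanSpace ℝ (Fin 3)) : ℝ) / 2))).mul_const K
    simpa using h
  have h0 : ‖fderiv ℝ (v t) x‖ ≤ 0 :=
    ge_of_tendsto hlim ((eventually_gt_atTop 0).mono fun S hS => hgrad S hS)
  exact norm_le_zero_iff.1 h0

/-- **Every line-invariant member of the EEL′ class is identically zero** (`A_ess ≤ I ≠ ∞` on all
parabolic balls suffices; `∇v ≡ 0` by `fderiv_eq_zero_of_lineInvariant`, so all slices are constant
and `slice_eq_zero_of_const_of_cknAEss_le` applies). [cite: KochNadirashviliSereginSverak2009, Thm 5.1 (arXiv:0709.3599 p. 9)] -/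
theorem lineInvariant_eq_zero (hv : ContDiff ℝ (⊤ : ℕ∞) (uncurry v))
    (hdiv : ∀ t, VectorCalculus.IsDivFree (v t))
    (hmild : ∀ s t : ℝ, s < t → ∀ x, v t x = heatFlow (v s) (t - s) x - oseenDuhamel 1 s v v t x)
    (hbdd : ∃ C : ℝ, ∀ t x, ‖v t x‖ ≤ C)
    (hinv : ∀ (t : ℝ) (x : EuclideanSpace ℝ (Fin 3)) (δ : ℝ), v t (x + EuclideanSpace.single 1 δ) = v t x)
    {I : ℝ≥0∞} (hI : I ≠ ⊤)
    (hA : ∀ r : ℝ, 0 < r → ∀ z : ℝ × EuclideanSpace ℝ (Fin 3), cknAEss r z v ≤ I)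
    (t : ℝ) (x : EuclideanSpace ℝ (Fin 3)) : v t x = 0 := by
  have h0 : ∀ (s : ℝ) (y : EuclideanSpace ℝ (Fin 3)), fderiv ℝ (v s) y = 0 := fun s y =>
    fderiv_eq_zero_of_lineInvariant hv hdiv hmild hbdd hinv hI hA s y
  have hconst : ∀ (s : ℝ) (y : EuclideanSpace ℝ (Fin 3)), v s y = v s 0 := fun s =>
    slice_const_of_fderiv_eq_zero hv (h0 s)
  have hc : Continuous fun s => v s 0 := hv.continuous.comp (continuous_id.prodMk continuous_const)
  exact slice_eq_zero_of_const_of_cknAEss_le hc hconst hI hA t x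

variable (v) in
/-- **EEL′ holds on the 2½-dimensional stratum** — in the exact hypothesis shape of
`EternalSplit.typeIliouvilleNoTypeII_of_pressureFreeSlab_of_eternalLiouville` (`hEEL`), restricted to
profiles invariant under the translations `x ↦ x + δ e₁`: such a `v` with `A`, `C`, `E` bounded by a
finite `I` on all parabolic balls has `v(0, 0) = 0` (indeed `v ≡ 0`).  Unconditional: KNSS's planar
Liouville theorem (Thm 5.1) and the 2½D bridge are tree theorems, the axial component is caloric,
and the `A`-clause removes the constants; the `C`- and `E`-clauses are NOT used. [cite: KochNadirashviliSereginSverak2009, Thm 5.1, §4 (ii) and proof of Thm 6.2 (arXiv:0709.3599 pp. 8–13)] -/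
theorem eternalLiouvillePressureFree_lineInvariant
    (hv : ContDiff ℝ (⊤ : ℕ∞) (uncurry v)) (hdiv : ∀ t, VectorCalculus.IsDivFree (v t))
    (hmild : ∀ s t : ℝ, s < t → ∀ x, v t x = heatFlow (v s) (t - s) x - oseenDuhamel 1 s v v t x)
    (hbd : ∀ (t : ℝ) (x : EuclideanSpace ℝ (Fin 3)), ‖v t x‖ ≤ 2)
    (hI : ∃ I : ℝ≥0∞, I ≠ ⊤ ∧ ∀ r : ℝ, 0 < r → ∀ z : ℝ × EuclideanSpace ℝ (Fin 3),
      cknAEss r z v ≤ I ∧ cknC r z v ≤ I ∧ cknE r z (fun s y => fderiv ℝ (v s) y) ≤ I)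
    (hinv : ∀ (t : ℝ) (x : EuclideanSpace ℝ (Fin 3)) (δ : ℝ), v t (x + EuclideanSpace.single 1 δ) = v t x) :
    v 0 0 = 0 := by
  obtain ⟨I, hItop, hball⟩ := hI
  exact lineInvariant_eq_zero hv hdiv hmild ⟨2, hbd⟩ hinv hItop (fun r hr z => (hball r hr z).1) 0 0

end Summit.NavierStokesRegularity.NavierStokesRegularity.Theorems.TypeIliouvilleNoTypeII.TypeIIZoom

end
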